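import Summits.BirchSwinnertonDyer.BirchSwinnertonDyer.Theorems.ManinLocalTwoThreeKatoShiftTwoCharacters
import Summits.BirchSwinnertonDyer.BirchSwinnertonDyer.Theorems.ManinLocalTwoThreeKatoShiftTwoPrimeClassPlus
import Summits.BirchSwinnertonDyer.BirchSwinnertonDyer.Theorems.ManinLocalTwoThreeManinPrimeToThreeAtNineKatoShiftLever
import Literature.NumberTheory.EllipticCurves.SkinnerUrban2014.PAdicUnitPeriodRatioAnyPrimeProofs
import Literature.NumberTheory.EllipticCurves.GaloisAction

/-!
# Route `ManinLocalTwoThree`, crux C2 `ManinOddAtFour` (stmt-BirchSwinnertonDyer-22967), line `kato-shift-two`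
# (es g7): the Euler-system step `stub_two_dvd_multiShiftClass` — GRANTED the `p = 2` Kato fact (F-es-21,
# stated BY VALUE here: not yet a Literature constant), at a lattice-optimal datum with `4 ∣ N`, `W` additive at
# `2`, `W[2]` irreducible, `2 ∣ c` and (`Δ < 0` or `4 ∣ c`), every MULTI-SHIFT class over an admissible prime
# `ℓ` has REAL part in `2ℤ·(Ω⁺_f/2)` (line prover p1; helper)

Assembly of `…KatoShiftTwoMultiShift` / `…TwoCharacters` / `…TwoPrimeClassPlus` with the fact:
* `KatoFactTwoPolar` is NOT declared: the fact is the explicit hypothesis `hK`, VERBATIM the body of the line's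
  `katoNeron_twoAdic_isIntegral_twistedSymbolSum_of_additive_polar` (HOME/es/Line-es-kato-shift-two-reg.lean §2,
  cf35a6738bf8791d) with its local abbreviations `symmEuler`, `realComponents` INLINED; when T-es-10 lands the
  fact in `Literature/` a one-line adapter feeds it here.
* `pint_charSumPlus_div_four` — for ONE even `χ` off all holes (`χ(8) ≠ 1`, `χ(q) ≠ 1` at the `q ∥ N`):
  `(Σ_a χ(a) x(a))/4` is `2`-integral (`Ω(W) = |c|·Ω⁺_f`, `ϖ = 1/|c|`, `r = E(χ)·A/2`; the case split
  `4 ∣ c` / `Δ < 0` absorbs the archimedean factor `#π₀(W(ℝ))`).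
* `exists_int_re_multiShiftClass_eq_two_mul` — **the stub's conclusion**:
  `Re(Σ_{T ⊆ Gen(N)} (−1)^{|T|} {0, a·∏T/ℓ}_f) = 2n·(Ω⁺_f/2)`, `Gen(N) = {8} ∪ {q ∥ N}`, for every admissible
  `ℓ` (`ℓ ∤ N` prime, `ℓ ≡ 3 (mod 4)`, no `t ∈ Gen(N)` is `±1 mod ℓ`) and `0 < a < ℓ`.
Nothing about BSD is proved here; Manin's conjecture at `2` is NOT proved here (the line still needs the
multi-shift generation law E-es-22 and two residuals, and F-es-21 is a statement-only fact).
-/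

set_option autoImplicit false
set_option linter.dupNamespace false

noncomputable section

open scoped Classical MatrixGroups ModularForm

open CongruenceSubgroup Complex Literature.NumberTheory.EllipticCurves
  Literature.NumberTheory.EllipticCurves.ModularForms
  Summit.BirchSwinnertonDyer.BirchSwinnertonDyer.Theorems.ManinFrameResidueProperRTameTwist

namespace Summit.BirchSwinnertonDyer.BirchSwinnertonDyer.Theorems.ManinLocalTwoThree

section TwoStep

variable {W : WeierstrassCurve ℚ} [W.IsElliptic] [W.IsGloballyMinimal] {N : ℕ} [NeZero N]

/-- **One even character off the holes: `(Σ_a χ(a) x(a))/4` is `2`-integral**, GRANTED the `p = 2` Kato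
fact `hK` (by value), at a lattice-optimal datum of a curve additive at `2` with `W[2]` irreducible, `2 ∣ c` and
(`Δ < 0` or `4 ∣ c`), for a prime `ℓ ∤ N`, `ℓ ≡ 3 (mod 4)`, an EVEN `χ` mod `ℓ` with `χ(8) ≠ 1` and `χ(q) ≠ 1`
at every `q ∥ N`. [cite: Kato2004Asterisque, Thm. 9.7 (p. 189)] [cite: KostersPannekoek2017, Thm. 1, §3.3.1] -/
theorem pint_charSumPlus_div_four
    (hK : ∀ (V : WeierstrassCurve ℚ) [V.IsElliptic] [V.IsGloballyMinimal] {N : ℕ} [NeZero N]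
      (f : CuspForm (Gamma0 N) 2) (_ : IsNewformOf V f)
      (_ : ¬ V.HasGoodReductionAtPrime 2) (_ : ¬ V.HasMultiplicativeReductionAtPrime 2)
      (_ : V.HasIrreducibleModPGaloisRep 2) (m : ℕ) [NeZero m] (_ : m.Coprime (2 * N))
      (χ : DirichletCharacter ℂ m) (_ : χ.IsPrimitive) (_ : χ ≠ 1) (_ : ¬ 2 ∣ orderOf χ)
      (_ : χ (8 : ZMod m) ≠ 1) (ϖ : ℚ) (r : ℂ),
      (ϖ : ℝ) * V.realPeriodRat = plusPeriod f →
        (∏ ℓ ∈ N.primeFactors with ¬ ℓ ^ 2 ∣ N,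
            (((ℓ : ℂ) - (V.LFunction ℓ : ℂ) * χ (ℓ : ZMod m)) *
              ((ℓ : ℂ) - (V.LFunction ℓ : ℂ) * (χ (ℓ : ZMod m))⁻¹))) *
          twistedSymbolSum f χ = r * (plusPeriod f : ℂ) →
        ∃ s : ℕ, ¬ 2 ∣ s ∧
          IsIntegral ℤ ((s : ℂ) * ((if 0 < V.Δ then (2 : ℕ) else 1 : ℕ) : ℂ) * ϖ * r))
    (D : ModularParametrizationData W N)
    (hopt : ∀ z ∈ D.L.lattice, ∃ w ∈ periodLattice D.f, z = D.c * w)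
    (hadd : ¬ W.HasGoodReductionAtPrime 2 ∧ ¬ W.HasMultiplicativeReductionAtPrime 2)
    (hirr : W.HasIrreducibleModPGaloisRep 2) (h2c : (2 : ℤ) ∣ D.c) (hΔ : W.Δ < 0 ∨ (4 : ℤ) ∣ D.c)
    (h4 : 2 ^ 2 ∣ N) {ℓ : ℕ} (hℓ : ℓ.Prime) (hℓN : ¬ ℓ ∣ N) (h4ℓ : ℓ % 4 = 3)
    {x : ZMod ℓ → ℤ}
    (hx : ∀ v : ZMod ℓ, (modularSymbol D.f (((v.val : ℕ) : ℚ) / ℓ) - modularSymbol D.f 0).re =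
      x v * (plusPeriod D.f / 2))
    (χ : DirichletCharacter ℂ ℓ) (hχ : χ.Even) (hχ8 : χ (8 : ZMod ℓ) ≠ 1)
    (hholes : ∀ q ∈ N.primeFactors, ¬ q ^ 2 ∣ N → χ (q : ZMod ℓ) ≠ 1) :
    haveI : NeZero ℓ := ⟨hℓ.ne_zero⟩
    ∃ s : ℕ, ¬ 2 ∣ s ∧ IsIntegral ℤ ((s : ℂ) * ((∑ a : ZMod ℓ, χ a * (x a : ℂ)) / 4)) := by
  haveI : NeZero ℓ := ⟨hℓ.ne_zero⟩
  haveI : Fact ℓ.Prime := ⟨hℓ⟩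
  have hℓ2 : ℓ ≠ 2 := by omega
  have hreal : ∀ n, (cuspCoeff D.f n).im = 0 :=
    cuspCoeff_im_eq_zero_of_coeffField_eq_bot D.isNewformOf.coeffField_eq_bot
  have hΩf : 0 < plusPeriod D.f :=
    IsNewform0.plusPeriod_pos_holds D.isNewformOf.1 D.isNewformOf.coeffField_eq_bot
  have hc0 : D.c ≠ 0 := D.maninConstant_ne_zero_holds
  -- `χ ≠ 1`, odd order, primitive
  have h8u : IsUnit (8 : ZMod ℓ) := by
    have : (8 : ZMod ℓ) = ((2 ^ 3 : ℕ) : ZMod ℓ) := by norm_num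
    rw [this, ZMod.isUnit_iff_coprime]
    exact Nat.Coprime.pow_left 3 ((Nat.coprime_primes Nat.prime_two hℓ).mpr hℓ2.symm)
  have hχ1 : χ ≠ 1 := by
    intro h; apply hχ8; rw [h, MulChar.one_apply h8u]
  have hord : ¬ 2 ∣ orderOf χ := not_two_dvd_orderOf_of_even h4ℓ hχ
  have hprim : χ.IsPrimitive := isPrimitive_of_ne_one hχ1
  have hm : ℓ.Coprime (2 * N) := Nat.Coprime.mul_right
    ((Nat.coprime_primes hℓ Nat.prime_two).mpr hℓ2) ((hℓ.coprime_iff_not_dvd).mpr hℓN)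
  -- `Ω(W) = |c|·Ω⁺_f`, `ϖ = 1/|c|`
  have hΩW : W.realPeriodRat = |(D.c : ℝ)| * plusPeriod D.f :=
    D.realPeriodRat_eq_abs_mul_plusPeriod_of_latticeEq hopt
  set cabs : ℤ := |D.c| with hcabs
  have hcabs0 : cabs ≠ 0 := abs_ne_zero.mpr hc0
  set ϖ : ℚ := 1 / (cabs : ℚ) with hϖdef
  have hϖ : (ϖ : ℝ) * W.realPeriodRat = plusPeriod D.f := by
    rw [hϖdef, hΩW]; push_cast; rw [hcabs, Int.cast_abs]
    have : |(D.c : ℝ)| ≠ 0 := abs_ne_zero.mpr (by exact_mod_cast hc0)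
    field_simp
  -- `T = (Ω⁺/2)·A`
  set A : ℂ := ∑ a : ZMod ℓ, χ a * (x a : ℂ) with hAdef
  set E : ℂ := ∏ q ∈ N.primeFactors with ¬ q ^ 2 ∣ N,
      (((q : ℂ) - (W.LFunction q : ℂ) * χ (q : ZMod ℓ)) *
        ((q : ℂ) - (W.LFunction q : ℂ) * (χ (q : ZMod ℓ))⁻¹)) with hEdef
  have hT : twistedSymbolSum D.f χ = ((plusPeriod D.f / 2 : ℝ) : ℂ) * A := by
    have hpt : ∀ v : ZMod ℓ, χ v *
        (((modularSymbol D.f (((v.val : ℕ) : ℚ) / ℓ) - modularSymbol D.f 0).re : ℝ) : ℂ) =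
        ((plusPeriod D.f / 2 : ℝ) : ℂ) * (χ v * (x v : ℂ)) := by
      intro v; rw [hx v]; push_cast; ring
    rw [twistedSymbolSum_eq_sum_re_of_even D.f hℓ.ne_zero hreal χ hχ hχ1,
      Finset.sum_congr rfl (fun v _ ↦ hpt v), ← Finset.mul_sum]
  set r : ℂ := E * A / 2 with hrdef
  have hval : E * twistedSymbolSum D.f χ = r * (plusPeriod D.f : ℂ) := by
    rw [hT, hrdef]; push_cast; ring
  obtain ⟨s, hs, hint⟩ := hK W D.f D.isNewformOf hadd.1 hadd.2 hirr ℓ hm χ hprim hχ1 hord hχ8 ϖ r hϖ hval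
  -- `s·π₀·ϖ·r = s·π₀·E·A/(2|c|)`; absorb `π₀` and `|c|` to get `s·E·(A/4)` integral
  have hcabsC : ((cabs : ℤ) : ℂ) ≠ 0 := by exact_mod_cast hcabs0
  have hϖC : (ϖ : ℂ) = 1 / ((cabs : ℤ) : ℂ) := by rw [hϖdef]; push_cast; rfl
  have hint2 : IsIntegral ℤ ((s : ℂ) * (E * (A / 4))) := by
    rcases hΔ with hneg | h4c
    · -- `Δ < 0`: `π₀ = 1`, `|c| = 2|k|`, multiply by `|k|`
      have hπ : (if 0 < W.Δ then (2 : ℕ) else 1 : ℕ) = 1 := if_neg (not_lt.mpr hneg.le)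
      rw [hπ] at hint
      obtain ⟨k, hk⟩ := h2c
      have hk0 : k ≠ 0 := by rintro rfl; exact hc0 (by rw [hk, mul_zero])
      have habs : cabs = 2 * |k| := by rw [hcabs, hk, abs_mul]; norm_num
      have hkC : ((|k| : ℤ) : ℂ) ≠ 0 := by exact_mod_cast (abs_ne_zero.mpr hk0)
      have hkey : (((|k| : ℤ)) : ℂ) * ((s : ℂ) * ((1 : ℕ) : ℂ) * (ϖ : ℂ) * r) =
          (s : ℂ) * (E * (A / 4)) := by
        rw [hϖC, hrdef, habs]; push_cast; field_simp; try ring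
      rw [← hkey]
      exact (isIntegral_algebraMap (R := ℤ) (x := (|k| : ℤ))).mul hint
    · -- `4 ∣ c`: `|c| = 4|k|`, multiply by `|k|·(2/π₀)`
      obtain ⟨k, hk⟩ := h4c
      have hk0 : k ≠ 0 := by rintro rfl; exact hc0 (by rw [hk, mul_zero])
      have habs : cabs = 4 * |k| := by rw [hcabs, hk, abs_mul]; norm_num
      have hkC : ((|k| : ℤ) : ℂ) ≠ 0 := by exact_mod_cast (abs_ne_zero.mpr hk0)
      by_cases hpos : 0 < W.Δ
      · have hπ : (if 0 < W.Δ then (2 : ℕ) else 1 : ℕ) = 2 := if_pos hpos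
        rw [hπ] at hint
        have hkey : (((|k| : ℤ)) : ℂ) * ((s : ℂ) * ((2 : ℕ) : ℂ) * (ϖ : ℂ) * r) =
            (s : ℂ) * (E * (A / 4)) := by
          rw [hϖC, hrdef, habs]; push_cast; field_simp; try ring
        rw [← hkey]
        exact (isIntegral_algebraMap (R := ℤ) (x := (|k| : ℤ))).mul hint
      · have hπ : (if 0 < W.Δ then (2 : ℕ) else 1 : ℕ) = 1 := if_neg hpos
        rw [hπ] at hint
        have hkey : (((2 * |k| : ℤ)) : ℂ) * ((s : ℂ) * ((1 : ℕ) : ℂ) * (ϖ : ℂ) * r) =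
            (s : ℂ) * (E * (A / 4)) := by
          rw [hϖC, hrdef, habs]; push_cast; field_simp; try ring
        rw [← hkey]
        exact (isIntegral_algebraMap (R := ℤ) (x := (2 * |k| : ℤ))).mul hint
  have hpintEA : ∃ s : ℕ, ¬ 2 ∣ s ∧ IsIntegral ℤ ((s : ℂ) * (E * (A / 4))) := ⟨s, hs, hint2⟩
  -- cancel the `2`-unit `E`
  obtain ⟨w, t, hw, hEw, ht⟩ : ∃ (w : ℂ) (t : ℤ), IsIntegral ℤ w ∧ E * w = t ∧ ¬ ((2 : ℕ) : ℤ) ∣ t := by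
    refine exists_prod_mul_eq Nat.prime_two _ _ fun q hq ↦ ?_
    obtain ⟨hqN, hq2⟩ := Finset.mem_filter.mp hq
    have hqp : q.Prime := Nat.prime_of_mem_primeFactors hqN
    have hqne2 : q ≠ 2 := by rintro rfl; exact hq2 h4
    have hqℓ : q ≠ ℓ := by rintro rfl; exact hℓN (Nat.dvd_of_mem_primeFactors hqN)
    have hqu : IsUnit ((q : ℕ) : ZMod ℓ) := by
      rw [ZMod.isUnit_iff_coprime]
      exact (Nat.coprime_primes hqp hℓ).mpr hqℓ
    have ha : W.LFunction q = 1 ∨ W.LFunction q = -1 ∨ W.LFunction q = 0 :=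
      lFunction_eq_one_or_neg_one_or_zero_of_dvd_level D.isNewformOf hqp (Nat.dvd_of_mem_primeFactors hqN)
    exact exists_symmEulerFactor_mul_eq_two hqp hqne2 hqu ha hord (hholes q hqN hq2)
  exact pint_of_pint_mul_of_mul_eq Nat.prime_two hw hEw ht hpintEA

/-- **`stub_two_dvd_multiShiftClass` of the line `kato-shift-two`, conclusion form** (admissibility and the
multi-shift class spelled out; the fact `hK` by value): GRANTED the `p = 2` Kato fact, at a lattice-optimal
`X₀(N)`-datum `D` of a globally minimal `W` with `4 ∣ N`, `W` additive at `2`, `W[2]` irreducible, `2 ∣ c` and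
(`Δ_W < 0` or `4 ∣ c`), for every admissible `ℓ` (`ℓ ∤ N` prime, `ℓ ≡ 3 (mod 4)`, no hole generator
`t ∈ {8} ∪ {q ∥ N}` is `±1 mod ℓ`) and `0 < a < ℓ`:
`Re(Σ_{T ⊆ Gen(N)} (−1)^{|T|} ({∞, a∏T/ℓ}_f − {∞,0}_f)) = 2n·(Ω⁺_f/2)` for an integer `n`.
[cite: Kato2004Asterisque, Thm. 9.7 (p. 189)] [cite: KostersPannekoek2017, Thm. 1, §3.3.1]
[cite: MazurTateTeitelbaum1986, §I.8] -/
theorem exists_int_re_multiShiftClass_eq_two_mul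
    (hK : ∀ (V : WeierstrassCurve ℚ) [V.IsElliptic] [V.IsGloballyMinimal] {N : ℕ} [NeZero N]
      (f : CuspForm (Gamma0 N) 2) (_ : IsNewformOf V f)
      (_ : ¬ V.HasGoodReductionAtPrime 2) (_ : ¬ V.HasMultiplicativeReductionAtPrime 2)
      (_ : V.HasIrreducibleModPGaloisRep 2) (m : ℕ) [NeZero m] (_ : m.Coprime (2 * N))
      (χ : DirichletCharacter ℂ m) (_ : χ.IsPrimitive) (_ : χ ≠ 1) (_ : ¬ 2 ∣ orderOf χ)
      (_ : χ (8 : ZMod m) ≠ 1) (ϖ : ℚ) (r : ℂ),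
      (ϖ : ℝ) * V.realPeriodRat = plusPeriod f →
        (∏ ℓ ∈ N.primeFactors with ¬ ℓ ^ 2 ∣ N,
            (((ℓ : ℂ) - (V.LFunction ℓ : ℂ) * χ (ℓ : ZMod m)) *
              ((ℓ : ℂ) - (V.LFunction ℓ : ℂ) * (χ (ℓ : ZMod m))⁻¹))) *
          twistedSymbolSum f χ = r * (plusPeriod f : ℂ) →
        ∃ s : ℕ, ¬ 2 ∣ s ∧
          IsIntegral ℤ ((s : ℂ) * ((if 0 < V.Δ then (2 : ℕ) else 1 : ℕ) : ℂ) * ϖ * r))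
    (D : ModularParametrizationData W N)
    (hopt : ∀ z ∈ D.L.lattice, ∃ w ∈ periodLattice D.f, z = D.c * w) (h4 : 2 ^ 2 ∣ N)
    (hadd : ¬ W.HasGoodReductionAtPrime 2 ∧ ¬ W.HasMultiplicativeReductionAtPrime 2)
    (hirr : W.HasIrreducibleModPGaloisRep 2) (h2c : (2 : ℤ) ∣ D.c) (hΔ : W.Δ < 0 ∨ (4 : ℤ) ∣ D.c)
    {ℓ : ℕ} (hℓ : ℓ.Prime) (hℓN : ¬ ℓ ∣ N) (h4ℓ : ℓ % 4 = 3)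
    (hgen : ∀ t ∈ insert 8 (N.primeFactors.filter fun q ↦ ¬ q ^ 2 ∣ N),
      (t : ZMod ℓ) ≠ 1 ∧ (t : ZMod ℓ) ≠ -1)
    (a : ℕ) (ha0 : 0 < a) (haℓ : a < ℓ) :
    ∃ n : ℤ, (∑ T ∈ (insert 8 (N.primeFactors.filter fun q ↦ ¬ q ^ 2 ∣ N)).powerset,
        (-1 : ℂ) ^ T.card *
          (modularSymbol D.f (((a * ∏ t ∈ T, t : ℕ) : ℚ) / ℓ) - modularSymbol D.f 0)).re =
      2 * n * (plusPeriod D.f / 2) := by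
  haveI : NeZero ℓ := ⟨hℓ.ne_zero⟩
  haveI : Fact ℓ.Prime := ⟨hℓ⟩
  have hℓ2 : ℓ ≠ 2 := by omega
  set Gen : Finset ℕ := insert 8 (N.primeFactors.filter fun q ↦ ¬ q ^ 2 ∣ N) with hGen
  obtain ⟨x, hx, heven⟩ := exists_latticeCoordPlus D hℓ hℓN
  -- the hole generators as units mod `ℓ`
  have hcop : ∀ t ∈ Gen, Nat.Coprime t ℓ := by
    intro t ht
    rw [hGen, Finset.mem_insert, Finset.mem_filter] at ht
    rcases ht with rfl | ⟨htN, _⟩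
    · exact Nat.Coprime.pow_left 3 ((Nat.coprime_primes Nat.prime_two hℓ).mpr hℓ2.symm)
    · have htp : t.Prime := Nat.prime_of_mem_primeFactors htN
      have htℓ : t ≠ ℓ := by rintro rfl; exact hℓN (Nat.dvd_of_mem_primeFactors htN)
      exact (Nat.coprime_primes htp hℓ).mpr htℓ
  let g : ℕ → (ZMod ℓ)ˣ := fun t ↦ if h : Nat.Coprime t ℓ then ZMod.unitOfCoprime t h else 1
  have hg : ∀ t ∈ Gen, ((g t : (ZMod ℓ)ˣ) : ZMod ℓ) = (t : ZMod ℓ) := by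
    intro t ht
    simp only [g, dif_pos (hcop t ht), ZMod.coe_unitOfCoprime]
  -- the unit `a`
  have hacop : Nat.Coprime a ℓ :=
    Nat.Coprime.symm ((Nat.Prime.coprime_iff_not_dvd hℓ).mpr (Nat.not_dvd_of_pos_of_lt ha0 haℓ))
  set β : (ZMod ℓ)ˣ := ZMod.unitOfCoprime a hacop with hβ
  have hβa : (β : ZMod ℓ) = (a : ZMod ℓ) := by rw [hβ, ZMod.coe_unitOfCoprime]
  -- the Kato input for `two_dvd_multiShift_of_pint'`
  have hA : ∀ χ : DirichletCharacter ℂ ℓ, χ.Even → (∀ t ∈ Gen, χ (g t : ZMod ℓ) ≠ 1) →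
      ∃ n : ℕ, ¬ 2 ∣ n ∧ IsIntegral ℤ ((n : ℂ) * ((∑ w : ZMod ℓ, χ w * (x w : ℂ)) / 4)) := by
    intro χ hχ hholes
    have h8 : χ (8 : ZMod ℓ) ≠ 1 := by
      have := hholes 8 (by rw [hGen]; exact Finset.mem_insert_self _ _)
      rw [hg 8 (by rw [hGen]; exact Finset.mem_insert_self _ _)] at this
      exact_mod_cast this
    have hq : ∀ q ∈ N.primeFactors, ¬ q ^ 2 ∣ N → χ (q : ZMod ℓ) ≠ 1 := by
      intro q hqN hq2
      have hmem : q ∈ Gen := by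
        rw [hGen, Finset.mem_insert, Finset.mem_filter]; exact Or.inr ⟨hqN, hq2⟩
      have := hholes q hmem
      rwa [hg q hmem] at this
    exact pint_charSumPlus_div_four hK D hopt hadd hirr h2c hΔ h4 hℓ hℓN h4ℓ hx χ hχ h8 hq
  obtain ⟨n, hn⟩ := two_dvd_multiShift_of_pint' h4ℓ x heven Gen g hA β
  refine ⟨n, ?_⟩
  -- rewrite each class through `x`
  have hterm : ∀ T ∈ Gen.powerset,
      ((-1 : ℂ) ^ T.card *
        (modularSymbol D.f (((a * ∏ t ∈ T, t : ℕ) : ℚ) / ℓ) - modularSymbol D.f 0)).re =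
      ((-1 : ℤ) ^ T.card * x ((β : ZMod ℓ) * ((∏ i ∈ T, g i : (ZMod ℓ)ˣ) : ZMod ℓ)) : ℝ) *
        (plusPeriod D.f / 2) := by
    intro T hT
    have hTsub : T ⊆ Gen := Finset.mem_powerset.mp hT
    have h1 : modularSymbol D.f (((a * ∏ t ∈ T, t : ℕ) : ℚ) / ℓ) =
        modularSymbol D.f (((((a * ∏ t ∈ T, t : ℕ) : ZMod ℓ).val : ℕ) : ℚ) / ℓ) := by
      have := modularSymbol_div_eq_of_intCast D.f hℓ.ne_zero ((a * ∏ t ∈ T, t : ℕ) : ℤ)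
      rw [Int.cast_natCast] at this
      rw [this]; push_cast; ring_nf
    have h2 : ((a * ∏ t ∈ T, t : ℕ) : ZMod ℓ) = (β : ZMod ℓ) * ((∏ i ∈ T, g i : (ZMod ℓ)ˣ) : ZMod ℓ) := by
      rw [hβa, Units.coe_prod]; push_cast
      congr 1
      exact Finset.prod_congr rfl fun t ht ↦ (hg t (hTsub ht)).symm
    have hre : ((-1 : ℂ) ^ T.card *
        (modularSymbol D.f (((a * ∏ t ∈ T, t : ℕ) : ℚ) / ℓ) - modularSymbol D.f 0)).re =
        (-1 : ℝ) ^ T.card *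
          (modularSymbol D.f (((a * ∏ t ∈ T, t : ℕ) : ℚ) / ℓ) - modularSymbol D.f 0).re := by
      rw [show ((-1 : ℂ) ^ T.card) = (((-1 : ℝ) ^ T.card : ℝ) : ℂ) by push_cast; ring,
        Complex.re_ofReal_mul]
    rw [hre, h1, hx, h2]; push_cast; ring
  rw [Complex.re_sum, Finset.sum_congr rfl hterm, ← Finset.sum_mul]
  have hn' := congrArg (fun z : ℤ ↦ (z : ℝ)) hn
  push_cast at hn' ⊢
  rw [hn']

end TwoStep

end Summit.BirchSwinnertonDyer.BirchSwinnertonDyer.Theorems.ManinLocalTwoThree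

end
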